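import Mathlib
import Summits.KontsevichZagierPeriods.KontsevichZagierPeriods.Theorems.SoloInformedSecondKindCycles
import Literature.NumberTheory.Transcendental.KZBetaChains
import Literature.NumberTheory.Transcendental.KZLogCalculusProofs
import Literature.NumberTheory.Transcendental.KZSemialgebraicComplex
import HarnessLib
import HarnessLib.Audit

/-!
# The second-kind companion of the `3`-isogeny move: W35 (solo-informed, s24) — THEOREM XIII‴

The last level-6 cycle relation of `y² = x³ + 1`, **W35** `2·B(½,⅚) = √3·B(½,⅔)`, realised
INSIDE the Kontsevich–Zagier calculus by the mechanism of Theorem XIII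
(`SoloInformedSecondKindInversion`) run through the CUBIC map of Theorem IX‴
(`SoloInformedIsogenyChain`): the `3`-isogeny `ψ(t) = 27t²/(4 − t)³` of the CM curve in Beta
coordinates.  Pulling the second-kind Beta form `u^{5/6−1}(1−u)^{1/2−1} du` back along `ψ`
gives

  `ψ^{−1/6}(1−ψ)^{−1/2} ψ′ = 9√3 · t^{2/3}(1−t)^{−1/2}(4−t)^{−2}`   (`soloInformed_isogeny₂_integrand_identity`;
                                                                  `9√3 = 27^{5/6}`)

— NOT a Beta form: a form of the rank-one local system of `β(⅔,½)` with a DOUBLE POLE at the new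
fibre point `t = 4` over `u = ∞` (Theorem XII (c): no direct Beta-to-Beta substitution reaches
`β(⅚,½)` from `β(⅔,½)`).  Rank one of `H¹(ℙ¹∖{0,1,∞}; L)` gives an exact correction with an
ALGEBRAIC primitive; explicitly, for all rationals `a, b, c` with `3a + 4b = 4`, `12c = a`,

  `t^{a}(1−t)^{b−1}/(4−t)² = c · t^{a−1}(1−t)^{b−1} + d/dt[ −⅓ · t^{a}(1−t)^{b}/(4−t) ]`
                                                                  (`soloInformed_secondKind₃_pointwise`),

the primitive vanishing at BOTH ends of `[0,1]` (`a, b > 0`); here `(a,b,c) = (⅔,½,1/18)`.  This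
file proves the two MOVES: the change of variables `[9√3 · S] − [β(⅚,½)] ∈ changeOfVariablesRel`
for the pulled-back representation `S = [(0,1), t^{2/3}(1−t)^{−1/2}/(4−t)²]`
(`soloInformed_isogeny₂_mem_changeOfVariablesRel`) and the Newton–Leibniz reduction
`S ∼ [(0,1), c·t^{a−1}(1−t)^{b−1}]` (`soloInformed_secondKind₃_reduction`: rule 3 over the point,
the null boundary, rule 1b).  The assembly — `⟦[pt, 9√3]⟧ · ⟦[pt, 1/18]⟧ · ⟦β(⅔,½)⟧ = ⟦β(⅚,½)⟧`,
**W35** `2 · ⟦β(⅚,½)⟧ = ⟦[pt, √3]⟧ · ⟦β(⅔,½)⟧`, values and hull memberships — is the sequel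
`SoloInformedSecondKindWThreeFive`.  With W45, W25 (`SoloInformedSecondKindCycles`) ALL second-kind
classes of level 6 are then tied to `⟦β(⅔,½)⟧` by kernel-checked chains WITHOUT cancellation and
without `π`.

References: M. Kontsevich, D. Zagier, *Periods* (2001), §1.2; J. Vélu, *Isogénies entre courbes
elliptiques*, C. R. Acad. Sci. Paris 273 (1971); P. Deligne, G. Mostow, *Monodromy of
hypergeometric functions and non-lattice integral monodromy*, Publ. IHÉS 63 (1986), §2;
G. Andrews, R. Askey, R. Roy, *Special Functions* (1999), §1.1; this work (solo-informed s24).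
-/

noncomputable section

open MeasureTheory Set Filter
open scoped Classical

open Literature.NumberTheory.Transcendental Literature.NumberTheory.Transcendental.KZ
open Literature.ModelTheory.ExponentialFields

namespace Summit.KontsevichZagierPeriods.KontsevichZagierPeriods.Theorems

/-! ### The integrand identity of the isogeny move on the second-kind form -/

/-- `(x^e)⁶ = x^k` when `6e = k` (`x ≥ 0`). [folklore] -/
theorem soloInformed_rpow_pow_six' {x : ℝ} (hx : 0 ≤ x) (e : ℝ) (k : ℕ) (h : e * 6 = (k : ℝ)) :
    (x ^ e) ^ 6 = x ^ k := by
  rw [← Real.rpow_natCast (x ^ e) 6, ← Real.rpow_mul hx, Nat.cast_ofNat, h, Real.rpow_natCast]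

/-- `(9√3)⁶ = 27⁵` (`9√3 = 27^{5/6}`). [folklore] -/
theorem soloInformed_nine_sqrt_three_pow_six : ((9:ℝ) * Real.sqrt 3) ^ 6 = 27 ^ 5 := by
  rw [mul_pow, soloInformed_sqrt_three_pow_six]
  norm_num

/-- **Integrand identity** (second kind, cubic map): for `t ∈ (0,1)`,
`9√3 · t^{2/3}(1−t)^{1/2−1}/(4−t)² = ψ(t)^{5/6−1} (1 − ψ(t))^{1/2−1} ψ′(t)`, `ψ(t) = 27t²/(4−t)³`
(both sides positive, sixth powers agree by `1 − ψ = (1−t)(t+8)²/(4−t)³`: every power of `t + 8`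
cancels, a double pole at `t = 4` remains). [this work] -/
theorem soloInformed_isogeny₂_integrand_identity {t : ℝ} (ht0 : 0 < t) (ht1 : t < 1) :
    9 * Real.sqrt 3 * ((t ^ (((2 / 3 : ℚ) : ℝ)) * (1 - t) ^ (((1 / 2 : ℚ) : ℝ) - 1)) / (4 - t) ^ 2) =
      soloInformedIsogenyFun t ^ (((5 / 6 : ℚ) : ℝ) - 1) *
        (1 - soloInformedIsogenyFun t) ^ (((1 / 2 : ℚ) : ℝ) - 1) * soloInformedIsogenyDeriv t := by
  have h4 : t ≠ 4 := ne_of_lt (by linarith)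
  have hψ0 : 0 < soloInformedIsogenyFun t := soloInformed_isogenyFun_pos ht0 (by linarith)
  have hψ1 : 0 < 1 - soloInformedIsogenyFun t :=
    sub_pos.2 (soloInformed_isogenyFun_lt_one ht0 ht1)
  have hψ' : 0 < soloInformedIsogenyDeriv t := soloInformed_isogenyDeriv_pos ht0 (by linarith)
  have h1t : 0 < 1 - t := by linarith
  have h4t : 0 < 4 - t := by linarith
  have h3 : 0 < Real.sqrt 3 := Real.sqrt_pos.2 (by norm_num)
  rw [← pow_left_inj₀ (by positivity) (by positivity) (by norm_num : (6:ℕ) ≠ 0)]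
  rw [mul_pow (9 * Real.sqrt 3), soloInformed_nine_sqrt_three_pow_six]
  simp only [mul_pow, div_pow]
  rw [soloInformed_rpow_pow_six' ht0.le _ 4 (by norm_num),
    soloInformed_rpow_pow_six h1t _ 3 (by norm_num),
    soloInformed_rpow_pow_six hψ0 _ 1 (by norm_num),
    soloInformed_rpow_pow_six hψ1 _ 3 (by norm_num),
    soloInformed_one_sub_isogenyFun h4]
  unfold soloInformedIsogenyFun soloInformedIsogenyDeriv
  have h4' : (4:ℝ) - t ≠ 0 := h4t.ne'
  have h8 : t + 8 ≠ 0 := ne_of_gt (by linarith)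
  have ht0' : t ≠ 0 := ht0.ne'
  have h1t' : 1 - t ≠ 0 := h1t.ne'
  field_simp

/-! ### The pulled-back representation `[(0,1), t^{a}(1−t)^{b−1}/(4−t)²]` -/

/-- The representation `S = [(0,1), t^{a}(1−t)^{b−1}/(4−t)²]` exists for rational `a, b > 0`
(semialgebraic integrand; integrable: the Beta integrand of `(a+1, b)` times a bounded continuous
factor). [this work] -/
theorem soloInformed_exists_secondKindRep₃ (a b : ℚ) (ha : 0 < a) (hb : 0 < b) :
    ∃ S : IntegralRep 1, S.domain = {t | t 0 ∈ Ioo (0:ℝ) 1} ∧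
      S.integrand = fun t => (t 0) ^ ((a : ℝ)) * (1 - t 0) ^ ((b : ℝ) - 1) / (4 - t 0) ^ 2 := by
  have haR : (0:ℝ) < a := by exact_mod_cast ha
  have hbR : (0:ℝ) < b := by exact_mod_cast hb
  have hsa : IsSemialgebraicFunOn ℚ {t : Fin 1 → ℝ | t 0 ∈ Ioo (0:ℝ) 1}
      (fun t => (t 0) ^ ((a : ℝ)) * (1 - t 0) ^ ((b : ℝ) - 1) / (4 - t 0) ^ 2) := by
    have hf := isSemialgebraicFunOn_const_mul_rpow_mul_rpow 1 a (b - 1)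
    have hg := isSemialgebraicFunOn_aeval BallPeeling.isSemialgebraic_posIoo
      ((4 - MvPolynomial.X 0) ^ 2 : MvPolynomial (Fin 1) ℚ)
    refine (IsSemialgebraicFunOn.div hf hg fun x hx => ?_).congr fun x _ => ?_
    · have hx' : 0 < x 0 ∧ x 0 < 1 := hx
      have : (4 - x 0) ≠ 0 := by linarith [hx'.2]
      simpa using pow_ne_zero 2 this
    · simp only [Rat.cast_one, one_mul, Rat.cast_sub, map_pow, map_sub, map_ofNat,
        MvPolynomial.aeval_X]
  have hI : IntegrableOn (fun t : ℝ => t ^ ((a : ℝ)) * (1 - t) ^ ((b : ℝ) - 1) / (4 - t) ^ 2)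
      (Ioo (0:ℝ) 1) := by
    have h1 : IntegrableOn (fun t : ℝ => t ^ ((a : ℝ)) * (1 - t) ^ ((b : ℝ) - 1)) (Ioo (0:ℝ) 1) := by
      have h := (Literature.Analysis.SpecialFunctions.Selberg.integrableOn_Ioo_rpow_mul_one_sub_rpow_and_integral_eq
        (by linarith : (0:ℝ) < a + 1) hbR).1
      simpa only [add_sub_cancel_right] using h
    have h2 : ContinuousOn (fun t : ℝ => ((4 - t) ^ 2)⁻¹) (Icc (0:ℝ) 1) :=
      ((continuousOn_const.sub continuousOn_id).pow 2).inv₀ fun t ht => by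
        show ((4:ℝ) - t) ^ 2 ≠ 0
        exact pow_ne_zero 2 (by linarith [ht.2] : (4:ℝ) - t ≠ 0)
    refine (h1.mul_continuousOn_of_subset h2 measurableSet_Ioo isCompact_Icc
      Ioo_subset_Icc_self).congr_fun (fun t _ => ?_) measurableSet_Ioo
    simp only [div_eq_mul_inv]
  exact ⟨⟨_, _, BallPeeling.isSemialgebraic_posIoo, hsa, integrableOn_setOf_apply_mem_iff.2 hI⟩,
    rfl, rfl⟩

/-! ### The cohomological reduction: `[S] ∼ [(0,1), c · t^{a−1}(1−t)^{b−1}]` -/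

/-- **Pointwise identity behind the reduction**: for `t ∈ (0,1)` and rationals with
`3a + 4b = 4`, `12c = a`, the derivative of `G(t) = −⅓ · t^a (1−t)^b (4−t)^{−1}` (in the shape
produced by the product rule) equals `t^{a}(1−t)^{b−1}/(4−t)² − c · t^{a−1}(1−t)^{b−1}`.
[this work] -/
theorem soloInformed_secondKind₃_pointwise (a b c : ℚ) (hab : 3 * a + 4 * b = 4)
    (hc : 12 * c = a) {t : ℝ} (ht : t ∈ Ioo (0:ℝ) 1) :
    -1 / 3 * (((a : ℝ) * t ^ ((a : ℝ) - 1) * (1 - t) ^ (b : ℝ) +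
        t ^ (a : ℝ) * (-1 * (b : ℝ) * (1 - t) ^ ((b : ℝ) - 1))) * (4 - t)⁻¹ +
      t ^ (a : ℝ) * (1 - t) ^ (b : ℝ) * (-(-1) / (4 - t) ^ 2)) =
    t ^ ((a : ℝ)) * (1 - t) ^ ((b : ℝ) - 1) / (4 - t) ^ 2 -
      (c : ℝ) * (t ^ ((a : ℝ) - 1) * (1 - t) ^ ((b : ℝ) - 1)) := by
  have ht0 : t ≠ 0 := ht.1.ne'
  have h1t : 1 - t ≠ 0 := (sub_pos.2 ht.2).ne'
  have h4 : (4:ℝ) - t ≠ 0 := by linarith [ht.2]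
  have hbq : (b : ℝ) = 1 - 3 / 4 * (a : ℝ) := by
    have h := congr_arg (fun x : ℚ => (x : ℝ)) hab
    push_cast at h
    linarith
  have hcq : (c : ℝ) = (a : ℝ) / 12 := by
    have h := congr_arg (fun x : ℚ => (x : ℝ)) hc
    push_cast at h
    linarith
  have e1 : t ^ ((a : ℝ)) = t ^ ((a : ℝ) - 1) * t := by
    rw [Real.rpow_sub_one ht0, div_mul_cancel₀ _ ht0]
  have e2 : (1 - t) ^ ((b : ℝ)) = (1 - t) ^ ((b : ℝ) - 1) * (1 - t) := by
    rw [Real.rpow_sub_one h1t, div_mul_cancel₀ _ h1t]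
  rw [e1, e2, hcq]
  rw [hbq]
  field_simp
  ring

/-- **The reduction (rules 1b, 3 and the null boundary).** For rationals `a, b > 0` with
`3a + 4b = 4` and `12c = a`, a representation `S` pinned as `[(0,1), t^{a}(1−t)^{b−1}/(4−t)²]` is
KZ-equivalent to any `ρ'` pinned as `[(0,1), c · t^{a−1}(1−t)^{b−1}]`: ONE Newton–Leibniz move
over the point with the primitive `G(t) = −⅓ t^a(1−t)^b/(4−t)` on `[0,1]` (`G(0) = G(1) = 0`, so
`[[0,1], G′] ∼ [pt, 0] ∼ 0`), the null boundary `{0,1}`, and ONE additivity of integrands.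
[Kontsevich–Zagier 2001, §1.2 rules (1),(3); this work] -/
theorem soloInformed_secondKind₃_reduction (a b c : ℚ) (hab : 3 * a + 4 * b = 4)
    (hc : 12 * c = a) (ha : 0 < a) (hb : 0 < b) (S ρ' : IntegralRep 1)
    (hSd : S.domain = {t | t 0 ∈ Ioo (0:ℝ) 1})
    (hSi : EqOn S.integrand
      (fun t => (t 0) ^ ((a : ℝ)) * (1 - t 0) ^ ((b : ℝ) - 1) / (4 - t 0) ^ 2) S.domain)
    (hρ'd : ρ'.domain = {t | t 0 ∈ Ioo (0:ℝ) 1})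
    (hρ'i : EqOn ρ'.integrand
      (fun t => (c : ℝ) * ((t 0) ^ ((a : ℝ) - 1) * (1 - t 0) ^ ((b : ℝ) - 1))) ρ'.domain) :
    Equivalent S ρ' := by
  have haR : (0:ℝ) < a := by exact_mod_cast ha
  have hbR : (0:ℝ) < b := by exact_mod_cast hb
  have ha' : (a:ℝ) ≠ 0 := haR.ne'
  have hb' : (b:ℝ) ≠ 0 := hbR.ne'
  -- the derivative of the primitive, extended by `0` to the closed interval
  set g : ℝ → ℝ := fun t => if t ∈ Ioo (0:ℝ) 1 then
      -1 / 3 * (((a : ℝ) * t ^ ((a : ℝ) - 1) * (1 - t) ^ (b : ℝ) +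
          t ^ (a : ℝ) * (-1 * (b : ℝ) * (1 - t) ^ ((b : ℝ) - 1))) * (4 - t)⁻¹ +
        t ^ (a : ℝ) * (1 - t) ^ (b : ℝ) * (-(-1) / (4 - t) ^ 2))
    else 0 with hgdef
  have hgt : ∀ t ∈ Ioo (0:ℝ) 1, g t =
      t ^ ((a : ℝ)) * (1 - t) ^ ((b : ℝ) - 1) / (4 - t) ^ 2 -
        (c : ℝ) * (t ^ ((a : ℝ) - 1) * (1 - t) ^ ((b : ℝ) - 1)) := fun t ht => by
    simp only [hgdef, if_pos ht]
    exact soloInformed_secondKind₃_pointwise a b c hab hc ht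
  -- integrability of `g`
  obtain ⟨S₀, hS₀d, hS₀i⟩ := soloInformed_exists_secondKindRep₃ a b ha hb
  have hIS : IntegrableOn (fun t : ℝ => t ^ ((a : ℝ)) * (1 - t) ^ ((b : ℝ) - 1) / (4 - t) ^ 2)
      (Ioo (0:ℝ) 1) := by
    have h := S₀.integrableOn
    rw [hS₀d, hS₀i] at h
    exact integrableOn_setOf_apply_mem_iff.1 h
  have hIA : IntegrableOn (fun t : ℝ => t ^ ((a : ℝ) - 1) * (1 - t) ^ ((b : ℝ) - 1)) (Ioo (0:ℝ) 1) :=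
    (Literature.Analysis.SpecialFunctions.Selberg.integrableOn_Ioo_rpow_mul_one_sub_rpow_and_integral_eq
      haR hbR).1
  have hgi : IntegrableOn g (Icc (0:ℝ) 1) := by
    rw [integrableOn_Icc_iff_integrableOn_Ioo]
    exact (hIS.sub (hIA.const_mul (c : ℝ))).congr_fun (fun t ht => (hgt t ht).symm)
      measurableSet_Ioo
  -- semialgebraicity of `g` on `[0,1]`
  have hg_sa : IsSemialgebraicFunOn ℚ {x : Fin 1 → ℝ | x 0 ∈ Icc (0:ℝ) 1}
      (fun x : Fin 1 → ℝ => g (x 0)) := by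
    refine isSemialgebraicFunOn_Icc_of_Ioo ?_ 0 0 (fun x hx => ?_) (fun x hx => ?_)
    · have hpos : ∀ x ∈ {x : Fin 1 → ℝ | x 0 ∈ Ioo (0:ℝ) 1}, (4 - x 0) ≠ 0 := fun x hx => by
        have hx' : 0 < x 0 ∧ x 0 < 1 := hx
        linarith [hx'.2]
      have h1 := isSemialgebraicFunOn_aeval BallPeeling.isSemialgebraic_posIoo
        ((4 - MvPolynomial.X 0) : MvPolynomial (Fin 1) ℚ)
      have h2 := isSemialgebraicFunOn_aeval BallPeeling.isSemialgebraic_posIoo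
        ((4 - MvPolynomial.X 0) ^ 2 : MvPolynomial (Fin 1) ℚ)
      have hA := IsSemialgebraicFunOn.div
        (IsSemialgebraicFunOn.add_holds
          (isSemialgebraicFunOn_const_mul_rpow_mul_rpow (-1 / 3 * a) (a - 1) b)
          (isSemialgebraicFunOn_const_mul_rpow_mul_rpow (1 / 3 * b) a (b - 1))) h1
        fun x hx => by simpa using hpos x hx
      have hB := IsSemialgebraicFunOn.div (isSemialgebraicFunOn_const_mul_rpow_mul_rpow (-1 / 3) a b)
        h2 fun x hx => by simpa using pow_ne_zero 2 (hpos x hx)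
      refine (IsSemialgebraicFunOn.add_holds hA hB).congr fun x hx => ?_
      have hx' : x 0 ∈ Ioo (0:ℝ) 1 := hx
      have hS : (4 - x 0) ≠ 0 := hpos x hx
      simp only [hgdef, if_pos hx', Pi.add_apply, Rat.cast_sub, Rat.cast_one, Rat.cast_neg,
        Rat.cast_mul, Rat.cast_div, Rat.cast_ofNat, map_pow, map_sub, map_ofNat,
        MvPolynomial.aeval_X]
      field_simp
      ring
    · have : x 0 ∉ Ioo (0:ℝ) 1 := fun h => by rw [hx] at h; exact lt_irrefl _ h.1
      simp only [hgdef, if_neg this, Rat.cast_zero]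
    · have : x 0 ∉ Ioo (0:ℝ) 1 := fun h => by rw [hx] at h; exact lt_irrefl _ h.2
      simp only [hgdef, if_neg this, Rat.cast_zero]
  -- the band representation `D = [[0,1], g]` and the base `Z = [pt, 0]`
  obtain ⟨D, hDd, hDi⟩ : ∃ D : IntegralRep 1, D.domain = {x : Fin 1 → ℝ | x 0 ∈ Icc (0:ℝ) 1} ∧
      D.integrand = fun x => g (x 0) :=
    ⟨⟨_, _, isSemialgebraic_setOf_apply_mem_Icc, hg_sa, integrableOn_setOf_apply_mem_iff.2 hgi⟩,
      rfl, rfl⟩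
  obtain ⟨Z, hZd, hZi⟩ : ∃ Z : IntegralRep 0, Z.domain = univ ∧ Z.integrand = 0 :=
    exists_zeroRep isSemialgebraic_univ
  -- the primitive `G(t) = -⅓ · t^a (1-t)^b (4-t)⁻¹`
  have hF_sa : IsSemialgebraicFunOn ℚ {x : Fin 1 → ℝ | x 0 ∈ Icc (0:ℝ) 1}
      (fun z : Fin 1 → ℝ => -1 / 3 * ((z 0) ^ (a : ℝ) * (1 - z 0) ^ (b : ℝ) * (4 - z 0)⁻¹)) := by
    refine isSemialgebraicFunOn_Icc_of_Ioo ?_ 0 0 (fun x hx => ?_) (fun x hx => ?_)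
    · have h1 := isSemialgebraicFunOn_aeval BallPeeling.isSemialgebraic_posIoo
        ((4 - MvPolynomial.X 0) : MvPolynomial (Fin 1) ℚ)
      refine (IsSemialgebraicFunOn.div (isSemialgebraicFunOn_const_mul_rpow_mul_rpow (-1 / 3) a b)
        h1 fun x hx => ?_).congr fun x _ => ?_
      · have hx' : 0 < x 0 ∧ x 0 < 1 := hx
        have : (4 - x 0) ≠ 0 := by linarith [hx'.2]
        simpa using this
      · simp only [map_sub, map_ofNat, MvPolynomial.aeval_X, div_eq_mul_inv]
        ring
    · simp only [hx, Real.zero_rpow ha', zero_mul, mul_zero, Rat.cast_zero]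
    · simp only [hx, sub_self, Real.zero_rpow hb', mul_zero, zero_mul, Rat.cast_zero]
  have hNL : of D - of Z ∈ newtonLeibnizRel := by
    refine ⟨0, D, Z, fun _ => ((0:ℕ):ℝ), fun _ => ((0:ℕ):ℝ) + 1,
      fun z => -1 / 3 * ((z (Fin.last 0)) ^ (a : ℝ) * (1 - z (Fin.last 0)) ^ (b : ℝ) *
        (4 - z (Fin.last 0))⁻¹),
      by rw [hDd]; exact hF_sa,
      by rw [hZd]; exact isSemialgebraicFunOn_natCast isSemialgebraic_univ 0, ?_,
      fun _ _ => by simp, ?_, ?_, ?_, ?_, rfl⟩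
    · rw [hZd]
      exact (isSemialgebraicFunOn_aeval isSemialgebraic_univ
        (((0:ℕ) : MvPolynomial (Fin 0) ℚ) + 1)).congr fun x _ => by simp
    · rw [hDd, hZd]
      ext z
      simp only [mem_univ, true_and, mem_setOf_eq, mem_Icc, Nat.cast_zero, zero_add]
      rfl
    · intro x _
      simp only [Fin.snoc_last, Nat.cast_zero, zero_add]
      exact continuousOn_const.mul
        (((continuousOn_id.rpow_const fun t _ => Or.inr haR.le).mul
          ((continuousOn_const.sub continuousOn_id).rpow_const fun t _ => Or.inr hbR.le)).mul
          ((continuousOn_const.sub continuousOn_id).inv₀ fun t ht => by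
            show (4:ℝ) - t ≠ 0
            exact (sub_pos.2 (lt_of_le_of_lt (show t ≤ 1 from ht.2) (by norm_num))).ne'))
    · intro x _ t ht
      simp only [Nat.cast_zero, zero_add] at ht
      simp only [Fin.snoc_last, hDi]
      rw [show (0 : Fin 1) = Fin.last 0 from rfl, Fin.snoc_last]
      have hgt' : g t = -1 / 3 * (((a : ℝ) * t ^ ((a : ℝ) - 1) * (1 - t) ^ (b : ℝ) +
          t ^ (a : ℝ) * (-1 * (b : ℝ) * (1 - t) ^ ((b : ℝ) - 1))) * (4 - t)⁻¹ +
          t ^ (a : ℝ) * (1 - t) ^ (b : ℝ) * (-(-1) / (4 - t) ^ 2)) := by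
        simp only [hgdef, if_pos ht]
      rw [hgt']
      have hS : (4 - t) ≠ 0 := by linarith [ht.2]
      have hd := ((hasDerivAt_rpow_mul_one_sub_rpow (a := (a:ℝ)) (b := (b:ℝ)) ht).mul
        (((hasDerivAt_id' t).const_sub (4:ℝ)).inv hS)).const_mul (-1 / 3 : ℝ)
      exact hd
    · intro x _
      simp only [hZi, Pi.zero_apply, Fin.snoc_last, Nat.cast_zero, zero_add, Real.one_rpow,
        sub_self, Real.zero_rpow hb', Real.zero_rpow ha', mul_zero, zero_mul, sub_zero]
  have hZ_mem : of Z ∈ relations := of_mem_relations_of_eqOn_zero Z (by rw [hZi]; exact fun _ _ => rfl)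
  have hD_mem : of D ∈ relations := by
    have := relations.add_mem (newtonLeibnizRel_subset_relations hNL) hZ_mem
    rwa [sub_add_cancel] at this
  -- its open restriction
  have hsub : {x : Fin 1 → ℝ | x 0 ∈ Ioo (0:ℝ) 1} ⊆ D.domain := by
    rw [hDd]
    exact fun x hx => ⟨hx.1.le, hx.2.le⟩
  set D₀ := D.restrict _ BallPeeling.isSemialgebraic_posIoo hsub with hD₀
  have hD₀_mem : of D₀ ∈ relations := by
    have h1 := D.of_sub_of_restrict_mem_relations BallPeeling.isSemialgebraic_posIoo hsub
      (by rw [hDd]; exact volume_setOf_Icc_diff_Ioo)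
    have := relations.sub_mem hD_mem h1
    rwa [sub_sub_cancel] at this
  -- integrand additivity on (0,1): S = D₀ + ρ'
  have hadd : of S - of D₀ - of ρ' ∈ integrandAddRel := by
    refine ⟨1, S, D₀, ρ', by rw [hSd]; rfl, by rw [hρ'd, hSd], fun x hx => ?_, rfl⟩
    have hx' : x 0 ∈ Ioo (0:ℝ) 1 := by rw [hSd] at hx; exact hx
    have hxρ' : x ∈ ρ'.domain := by rw [hρ'd]; exact hx'
    rw [Pi.add_apply, hSi hx, hρ'i hxρ']
    simp only [hD₀, IntegralRep.integrand_restrict, hDi]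
    rw [hgt _ hx']
    ring
  have := relations.add_mem (integrandAddRel_subset_relations hadd) hD₀_mem
  have h' : of S - of D₀ - of ρ' + of D₀ = of S - of ρ' := by abel
  rw [h'] at this
  exact this

/-! ### The change of variables along `ψ` (rule 2) -/

/-- `9√3` is algebraic over `ℚ`. [folklore] -/
theorem soloInformed_isAlgebraic_nine_sqrt_three : IsAlgebraic ℚ ((9:ℝ) * Real.sqrt 3) := by
  have h9 : IsAlgebraic ℚ ((9:ℕ):ℝ) := isAlgebraic_nat 9
  simpa using h9.mul (soloInformed_isAlgebraic_sqrt_natCast 3)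

/-- The lift of `ψ` to `ℝ¹` is the isogeny map of `SoloInformedIsogenyChain`. [folklore] -/
theorem soloInformed_lift_isogenyFun :
    soloInformedLift soloInformedIsogenyFun = soloInformedIsogenyMap := rfl

/-- **The second-kind isogeny move (rule 2).** For a pinned `S = [(0,1), t^{2/3}(1−t)^{1/2−1}/(4−t)²]`
and a pinned `B = β(⅚,½)`, the substitution `u = ψ(t) = 27t²/(4−t)³` gives
`[9√3 · S] − [B] ∈ changeOfVariablesRel`. [Kontsevich–Zagier 2001, §1.2 rule (2); this work] -/
theorem soloInformed_isogeny₂_mem_changeOfVariablesRel (S B : IntegralRep 1)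
    (hSd : S.domain = {t | t 0 ∈ Ioo (0:ℝ) 1})
    (hSi : EqOn S.integrand
      (fun t => (t 0) ^ (((2 / 3 : ℚ) : ℝ)) * (1 - t 0) ^ (((1 / 2 : ℚ) : ℝ) - 1) / (4 - t 0) ^ 2)
      S.domain)
    (hBd : B.domain = {t | t 0 ∈ Ioo (0:ℝ) 1})
    (hBi : EqOn B.integrand
      (fun t => (t 0) ^ (((5 / 6 : ℚ) : ℝ) - 1) * (1 - t 0) ^ (((1 / 2 : ℚ) : ℝ) - 1)) B.domain) :
    of (S.constMul ((9:ℝ) * Real.sqrt 3) soloInformed_isAlgebraic_nine_sqrt_three) - of B ∈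
      changeOfVariablesRel := by
  have hD4 : {t : Fin 1 → ℝ | t 0 ∈ Ioo (0:ℝ) 1} ⊆ {x | x 0 < 4} := fun x hx => by
    simp only [mem_setOf_eq] at hx ⊢
    linarith [hx.2]
  refine soloInformed_lift_mem_changeOfVariablesRel _ B (g' := soloInformedIsogenyDeriv)
    (by rw [IntegralRep.domain_constMul, hSd]) hBd ?_
    (fun t ht => soloInformed_hasDerivAt_isogenyFun (show t ≠ 4 from ne_of_lt (by linarith [ht.2])))
    (soloInformed_strictMonoOn_isogenyFun.injOn.mono Ioo_subset_Icc_self)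
    soloInformed_image_isogenyFun fun x hx => ?_
  · rw [IntegralRep.domain_constMul, hSd, soloInformed_lift_isogenyFun]
    exact soloInformed_isSemialgebraicMapOn_isogenyMap (hSd ▸ S.isSemialgebraic_domain) hD4
  · have hx' : 0 < x 0 ∧ x 0 < 1 := by
      rw [IntegralRep.domain_constMul, hSd] at hx
      exact hx
    have hΦ : soloInformedLift soloInformedIsogenyFun x ∈ B.domain := by
      rw [hBd, ← soloInformed_image_isogenyFun]
      exact mem_image_of_mem _ (show x 0 ∈ Ioo (0:ℝ) 1 from hx')
    have hxS : x ∈ S.domain := by rw [hSd]; exact hx'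
    rw [IntegralRep.integrand_constMul]
    dsimp only
    rw [hSi hxS, hBi hΦ,
      abs_of_pos (soloInformed_isogenyDeriv_pos hx'.1 (by linarith [hx'.2]))]
    exact soloInformed_isogeny₂_integrand_identity hx'.1 hx'.2

end Summit.KontsevichZagierPeriods.KontsevichZagierPeriods.Theorems

end
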